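import Mathlib
import Summits.MatrixMultiplication.Statement
import Summits.MatrixMultiplication.MatrixMultiplication.Theorems.GraphEquationsCoeffIdentity
import Summits.MatrixMultiplication.MatrixMultiplication.Theorems.GraphEquationsExponentOne
import Summits.MatrixMultiplication.MatrixMultiplication.Theses.GraphEquations

/-!
# Lines/birth.lean — BC3 birth skeleton — crux `MultiplicityReduction` (item stmt-MatrixMultiplication-27806) (`H_mult`, ATTACKED) of route `GraphEquations`

LINE «exponent ladder»: measure the non-reducedness of a correct equation system `E` for `W_n`
by its (generic) LOEWY EXPONENT — the least `M` with `g · 𝕀(W_n)^M ⊆ (tests of E)` for some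
`g ∉ 𝕀(W_n)` (Hilbert's Nullstellensatz gives some `M` for every correct system; `M = 1` is generic
reducedness).  Two OPEN stubs: cheap systems can be taken of BOUNDED exponent (`stub_exponentBound`,
the open core), bounded exponent descends to exponent one at cost `O(n^{β+ε})`
(`stub_exponentDescent`, derivative / flat-syzygy rounds); the third leg, exponent one ⇒ generically
reduced, is the PROVED rung `expOneReduced` (tree theorem `exponentOneReduced_holds`, module
`Theorems.GraphEquationsExponentOne`: differentiate `g·(c_il − Σ a b) = Σ q_s t_s` at a point of `W_n`
with `g ≠ 0` ⇒ the `C`-Jacobian has rank `n²`; the BC5 witness of the crux).  Composition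
`MultiplicityReduction_of` is a real proof (midpoint exponent); sorries exactly in the two stubs.
-/

namespace Summit.MatrixMultiplication.MatrixMultiplication.Cruxes.MultiplicityReduction.Birth

open Summit.MatrixMultiplication.MatrixMultiplication.Theorems.GraphEquations
  (EqSystem GraphVars mmGraph EqAdmissible EqAdmissibleRed)
open Summit.MatrixMultiplication.MatrixMultiplication.Theses.GraphEquations (MultiplicityReduction)


/-- STUB 1 (open core): admissible exponents are attained by families of BOUNDED Loewy exponent. -/
theorem stub_exponentBound : ∀ β : ℝ, 2 ≤ β → EqAdmissible β → ∀ β' : ℝ, β < β' →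
    ∃ M : ℕ, ∃ c : ℝ, ∀ n : ℕ, 1 ≤ n → ∃ E : EqSystem n, E.Correct ∧
      (∃ g : MvPolynomial (GraphVars n) ℂ, g ∉ MvPolynomial.vanishingIdeal ℂ (mmGraph n) ∧
        Ideal.span {g} * MvPolynomial.vanishingIdeal ℂ (mmGraph n) ^ M ≤
          Ideal.span {p | ∃ j ∈ E.tests, p = E.testPoly j}) ∧
      (E.cost : ℝ) ≤ c * (n : ℝ) ^ β' := by
  sorry

/-- STUB 2: bounded exponent descends to exponent one at cost `O(n^{β+ε})`
(derivative rounds on flat syzygies). -/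
theorem stub_exponentDescent : ∀ (M : ℕ) (β : ℝ), 2 ≤ β →
    (∃ c : ℝ, ∀ n : ℕ, 1 ≤ n → ∃ E : EqSystem n, E.Correct ∧
      (∃ g : MvPolynomial (GraphVars n) ℂ, g ∉ MvPolynomial.vanishingIdeal ℂ (mmGraph n) ∧
        Ideal.span {g} * MvPolynomial.vanishingIdeal ℂ (mmGraph n) ^ M ≤
          Ideal.span {p | ∃ j ∈ E.tests, p = E.testPoly j}) ∧
      (E.cost : ℝ) ≤ c * (n : ℝ) ^ β) →
    ∀ β' : ℝ, β < β' →
      ∃ c : ℝ, ∀ n : ℕ, 1 ≤ n → ∃ E : EqSystem n, E.Correct ∧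
        (∃ g : MvPolynomial (GraphVars n) ℂ, g ∉ MvPolynomial.vanishingIdeal ℂ (mmGraph n) ∧
          Ideal.span {g} * MvPolynomial.vanishingIdeal ℂ (mmGraph n) ≤
            Ideal.span {p | ∃ j ∈ E.tests, p = E.testPoly j}) ∧
        (E.cost : ℝ) ≤ c * (n : ℝ) ^ β' := by
  sorry

/-- RUNG (PROVED in the tree, `exponentOneReduced_holds`; formerly stub 3 / support item
`ExponentOneReduced`): exponent-one families are generically reduced families. -/
theorem expOneReduced : ∀ β : ℝ,
    (∃ c : ℝ, ∀ n : ℕ, 1 ≤ n → ∃ E : EqSystem n, E.Correct ∧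
      (∃ g : MvPolynomial (GraphVars n) ℂ, g ∉ MvPolynomial.vanishingIdeal ℂ (mmGraph n) ∧
        Ideal.span {g} * MvPolynomial.vanishingIdeal ℂ (mmGraph n) ≤
          Ideal.span {p | ∃ j ∈ E.tests, p = E.testPoly j}) ∧
      (E.cost : ℝ) ≤ c * (n : ℝ) ^ β) →
    EqAdmissibleRed β :=
  Summit.MatrixMultiplication.MatrixMultiplication.Theorems.GraphEquations.exponentOneReduced_holds

/-- COMPOSITION (kernel-checked, no sorry of its own): the two stubs and the rung give the crux BY NAME. -/
theorem MultiplicityReduction_of :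
    Summit.MatrixMultiplication.MatrixMultiplication.Theses.GraphEquations.MultiplicityReduction := by
  intro β hβ hadm β' hlt
  obtain ⟨M, hM⟩ := stub_exponentBound β hβ hadm ((β + β') / 2) (by linarith)
  exact expOneReduced β' (stub_exponentDescent M ((β + β') / 2) (by linarith) hM β' (by linarith))

end Summit.MatrixMultiplication.MatrixMultiplication.Cruxes.MultiplicityReduction.Birth

#print axioms Summit.MatrixMultiplication.MatrixMultiplication.Cruxes.MultiplicityReduction.Birth.MultiplicityReduction_of
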